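import Mathlib

/-!
# Route «KPlusLogSqLaw», crux `WeakLifting` (stmt-ValiantsHypothesis-19561) — REAL side of the tridiagonal sector:
# the UNIT-COEFFICIENT sub-sector — the unit tridiagonal design as a LACUNARY PENCIL (route-side `…Defs` file, D-0009 reviewed)

HONEST FRAMING.  Definitions only (nothing asserted), seat val-sym-lift-p1 (g18), cell `pub-symmetroid`, 2026-08-28, for the helper line
`--supports stmt-ValiantsHypothesis-19561` on the unit-coefficient sub-sector of the α register; consumed by `…TridiagonalRealStaticUnitNegativeType`
(this seat), which feeds the crossing-direction law (p633123 / p633729 / p635395) into val-sym-mdr-p2's inertia kit (pencil language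
`∑ₖ X^{dₖ} Sₖ` of `…MatrixDescartesInertiaIndexFormula`).  The unit static symmetric tridiagonal design of size `m` with diagonal exponents
`d` and link exponents `f` (continuant currency `StaticTridiagonalRealPotential.pathDet (fun _ => 1) d (fun _ => 1) f m`) IS the lacunary pencil
with one letter per matrix cell class:
* `unitLetter m (Sum.inl i)` — the diagonal cell `(i, i)` (entry `1` there, `0` elsewhere), exponent `unitExponent d f m (Sum.inl i) = d i`;
* `unitLetter m (Sum.inr k)` — the symmetric link `(k, k+1) + (k+1, k)` (the zero matrix when `k + 1 ≥ m`), exponent `f k`.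
So `∑ κ, x ^ unitExponent d f m κ • unitLetter m κ` is the evaluated unit path matrix (diagonal `x^{d_i}`, links `x^{f_k}`) and
`det (∑ κ, X ^ unitExponent d f m κ • (unitLetter m κ).map C)` is `pathDet (fun _ => 1) d (fun _ => 1) f m` (proved in the consumer file).
Nothing here bears on `WeakLifting` / `TropicalB` (stmt-19771) in their windows, Conjecture B, the Door-A registers, `MatrixDescartes`
(stmt-18050) or VP ≠ VNP.
[this seat; folklore: a matrix of monomials is a lacunary pencil with elementary letters]
-/

-- `Summit.ValiantsHypothesis.ValiantsHypothesis.…` repeats a component by the D-0017 layout (single-conjunct summit); the name is mandated.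
set_option linter.dupNamespace false
set_option autoImplicit false

namespace Summit.ValiantsHypothesis.ValiantsHypothesis.Theorems.KPlusLogSqLaw
namespace StaticTridiagonalRealUnit

/-- the LETTERS of the unit tridiagonal design of size `m` as a lacunary pencil: `Sum.inl i` ↦ the diagonal unit matrix cell `(i,i)`,
`Sum.inr k` ↦ the symmetric unit link `(k,k+1) + (k+1,k)` (zero when `k+1 ≥ m`). [this file] -/
def unitLetter (m : ℕ) : Fin m ⊕ Fin m → Matrix (Fin m) (Fin m) ℝ
  | Sum.inl i => Matrix.of fun a b => if a = i ∧ b = i then 1 else 0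
  | Sum.inr k => Matrix.of fun a b =>
      if ((a : ℕ) = k ∧ (b : ℕ) = (k : ℕ) + 1) ∨ ((a : ℕ) = (k : ℕ) + 1 ∧ (b : ℕ) = k) then 1 else 0

/-- the EXPONENTS of the letters: `d i` on the diagonal cell `i`, `f k` on the link `k`. [this file] -/
def unitExponent (d f : ℕ → ℕ) (m : ℕ) : Fin m ⊕ Fin m → ℕ
  | Sum.inl i => d i
  | Sum.inr k => f k

end StaticTridiagonalRealUnit
end Summit.ValiantsHypothesis.ValiantsHypothesis.Theorems.KPlusLogSqLaw
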